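import Mathlib
import Summits.KontsevichZagierPeriods.Zeta5Search.FourthOrderResidueB
import Summits.KontsevichZagierPeriods.Zeta5Search.SecondResidueLaw
import Summits.KontsevichZagierPeriods.Zeta5Search.TypeSpaceLawZeroFinal
import Summits.KontsevichZagierPeriods.Zeta5Search.ResidueIdentityBProof
import Summits.KontsevichZagierPeriods.Zeta5Search.ClusterValuationPairs
import Summits.KontsevichZagierPeriods.Zeta5Search.ClusterBoundSeries
import HarnessLib

/-!
# ζ(5) search — the residue side of the second residue law L5 with poles of order ≤ 4 (`liveKappaSum_small`)

HONEST FRAMING: systematic search; no irrationality claim unless certified.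

Cell `pub-zeta5`, gen-2 seat generation 15 (REPORT-gen2-g15 §6; item (K)(D)(∞) of REPORT-gen2-g14 §3/§6, requested BY NAME by
the typer seat gen-13 for the `ClassFrame` assembly of law (A5)).  For a datum `b` in the polytope, a prime `p ≥ 5` and an EVEN level
`M ≥ 10` such that every multipole class has class exponent `≥ −M` and `p(M − 4) ≤ 2d + 3` (so that the class rational function
`∏_w (X + w)^{E_w + M − 4}` vanishes to order ≥ 2 at infinity, `Σ_w E_w = −(2d + 5)`), the LIVE CLASS SUM
`Σ_{E_x ≤ −M+3, multipole} ĝ_x · κ̂_x`, `κ̂_x ∈ {cubicHat, curvHat, phiHat, 1}` on the layers `E_x + M = 0, 1, 2, 3`, is `≡ 0 (mod p)`: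
its image in `ZMod p` is twice the abstract fourth-order residue sum `Σ ḡ_x κ̄_x = 0` of `ResidueFour.sum_gBarE_mul_kapBar_eq_zero`
(file `FourthOrderResidueB`), because `ĝ_x ↦ 2ḡ_x` (`ResidueLaw.gBar_eq_cast_gHat`), `φ̂_{m,x} ↦ φ̄_{m,x}` (`cast_phiPow`, the
`m`-th power clone of `ResidueLaw.cast_phiHat`: the odd-centre bracket lands in the class of `b₀/2`), and single-pole classes have
`E_x ≥ −6 > −M + 3` (so the live classes are exactly the poles of the rational function).  No statement about ζ(5).
-/

open Finset

namespace Summit.KontsevichZagierPeriods.Zeta5Search.ResidueFour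

open Summit.KontsevichZagierPeriods.Zeta5Search.ClusterValuation
open Summit.KontsevichZagierPeriods.Zeta5Search.ResidueLaw
open Summit.KontsevichZagierPeriods.Zeta5Search.SecondOrder (phiHat phi2Hat curvHat gBar)
open Summit.KontsevichZagierPeriods.Zeta5Search.SecondResidueLaw (phi3Hat cubicHat)

variable {p : ℕ} [hp : Fact p.Prime]

/-! ## Single-pole classes are shallow -/

/-- A class with at most one pole has class exponent `≥ −6` (a pole has net exponent `≥ 1 − 7`). -/
theorem neg_six_le_classExp_of_classPoleCount_le_one (b : ℕ → ℤ) (p x : ℕ) (h : classPoleCount b p x ≤ 1) :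
    -6 ≤ classExp b p x := by
  classical
  have hnet : ∀ s, -6 ≤ netExp b s := fun s => by
    have := blockCount_le b s; unfold netExp; split_ifs <;> omega
  have hcorr : (0 : ℤ) ≤ (if ¬ (2 : ℤ) ∣ b 0 ∧ CentreIn b p x then 1 else 0) := by split_ifs <;> norm_num
  have hP : -6 ≤ ∑ s ∈ (classSet b p x).filter (fun s => netExp b s < 0), netExp b s := by
    unfold classPoleCount at h
    rcases Nat.le_one_iff_eq_zero_or_eq_one.1 h with h0 | h1
    · rw [Finset.card_eq_zero.1 h0, sum_empty]; norm_num
    · obtain ⟨s, hs⟩ := Finset.card_eq_one.1 h1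
      rw [hs, sum_singleton]; exact hnet s
  have hN : 0 ≤ ∑ s ∈ (classSet b p x).filter (fun s => ¬ netExp b s < 0), netExp b s :=
    sum_nonneg fun s hs => not_lt.1 (mem_filter.1 hs).2
  unfold classExp
  rw [← sum_filter_add_sum_filter_not (classSet b p x) (fun s => netExp b s < 0)]
  linarith

/-! ## `φ̂_{m,x}` modulo `p` -/

/-- **`φ̂_{m,x}` modulo `p`** (`m`-th power clone of `ResidueLaw.cast_phiHat`): the rational
`Σ_{s foreign} netExp(s)/(s − x)^m + [b₀ odd, centre foreign]/(b₀/2 − x)^m` is `p`-integral with image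
`Σ_{w ≠ x̄} classExp(w)·((w − x̄)⁻¹)^m` in `ZMod p`. -/
theorem cast_phiPow (b : ℕ → ℤ) (hp5 : 5 ≤ p) (x m : ℕ) :
    ¬ p ∣ ((∑ s ∈ (range ((b 0).toNat + 1)).filter (fun s => s % p ≠ x % p), (netExp b s : ℚ) / ((s : ℚ) - x) ^ m)
        + (if ¬ (2 : ℤ) ∣ b 0 ∧ ¬ CentreIn b p x then 1 / ((b 0 : ℚ) / 2 - x) ^ m else 0)).den ∧
    ((((∑ s ∈ (range ((b 0).toNat + 1)).filter (fun s => s % p ≠ x % p), (netExp b s : ℚ) / ((s : ℚ) - x) ^ m)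
        + (if ¬ (2 : ℤ) ∣ b 0 ∧ ¬ CentreIn b p x then 1 / ((b 0 : ℚ) / 2 - x) ^ m else 0) : ℚ)) : ZMod p)
      = ∑ w ∈ univ.erase (x : ZMod p), ((classExp b p w.val : ℤ) : ZMod p) * ((w - x)⁻¹) ^ m := by
  classical
  set S := (range ((b 0).toNat + 1)).filter (fun s => s % p ≠ x % p) with hS
  have hfac : ∀ s ∈ S, ¬ (p : ℤ) ∣ ((s : ℤ) - x) := by
    intro s hs h
    exact (mem_filter.1 hs).2 (Nat.modEq_iff_dvd.2 h).symm
  have hsx : ∀ s : ℕ, ((s : ℚ) - x) = (((s : ℤ) - x : ℤ) : ℚ) := fun s => by push_cast; ring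
  have hterm : ∀ s ∈ S, (netExp b s : ℚ) / ((s : ℚ) - x) ^ m
      = (netExp b s : ℚ) * ((((s : ℤ) - x : ℤ) : ℚ) ^ (-(m : ℤ))) := by
    intro s _
    rw [hsx, zpow_neg, zpow_natCast, div_eq_mul_inv]
  have hden1 : ∀ s ∈ S, ¬ p ∣ ((netExp b s : ℚ) / ((s : ℚ) - x) ^ m).den := by
    intro s hs
    rw [hterm s hs]
    exact PInt.mul (PInt.intCast _) (PInt.zpow_int (hfac s hs) _)
  have hcast1 : ∀ s ∈ S, ((((netExp b s : ℚ) / ((s : ℚ) - x) ^ m) : ℚ) : ZMod p)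
      = ((netExp b s : ℤ) : ZMod p) * (((s : ZMod p) - x)⁻¹) ^ m := by
    intro s hs
    rw [hterm s hs, PInt.cast_mul (PInt.intCast _) (PInt.zpow_int (hfac s hs) _), Rat.cast_intCast,
      PInt.cast_zpow_int (hfac s hs), zpow_neg, zpow_natCast, Int.cast_sub, Int.cast_natCast, Int.cast_natCast, inv_pow]
  have hdenS : ¬ p ∣ (∑ s ∈ S, (netExp b s : ℚ) / ((s : ℚ) - x) ^ m).den := PInt.sum hden1
  have hcastS : ((∑ s ∈ S, (netExp b s : ℚ) / ((s : ℚ) - x) ^ m : ℚ) : ZMod p)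
      = ∑ s ∈ S, ((netExp b s : ℤ) : ZMod p) * (((s : ZMod p) - x)⁻¹) ^ m := by
    rw [PInt.cast_sum hden1]
    exact sum_congr rfl hcast1
  -- group the foreign positions by residue class
  have hmaps : ∀ s ∈ S, (s : ZMod p) ∈ univ.erase (x : ZMod p) := by
    intro s hs
    exact mem_erase.2 ⟨fun h => (mem_filter.1 hs).2 ((ZMod.natCast_eq_natCast_iff' s x p).1 h), mem_univ _⟩
  have hfib : ∑ s ∈ S, ((netExp b s : ℤ) : ZMod p) * (((s : ZMod p) - x)⁻¹) ^ m
      = ∑ w ∈ univ.erase (x : ZMod p), ((∑ s ∈ classSet b p w.val, netExp b s : ℤ) : ZMod p) * ((w - x)⁻¹) ^ m := by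
    rw [← sum_fiberwise_of_maps_to hmaps]
    refine sum_congr rfl fun w hw => ?_
    have hfilter : S.filter (fun s : ℕ => (s : ZMod p) = w) = classSet b p w.val := by
      rw [← filter_natCast_eq_classSet b w, hS, filter_filter]
      refine filter_congr fun s _ => ⟨fun h => h.2, fun h => ⟨fun hsx' => (mem_erase.1 hw).1 ?_, h⟩⟩
      rw [← h, (ZMod.natCast_eq_natCast_iff' s x p).2 hsx']
    rw [hfilter, Int.cast_sum, sum_mul]
    refine sum_congr rfl fun s hs => ?_
    rw [← filter_natCast_eq_classSet b w] at hs
    rw [(mem_filter.1 hs).2]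
  -- the centre bracket
  set c : ZMod p := ((b 0 : ℤ) : ZMod p) / 2 with hc
  have h2Z : ¬ (p : ℤ) ∣ 2 := by
    intro h
    have := Int.le_of_dvd two_pos h
    have h5 : (5 : ℤ) ≤ p := by exact_mod_cast hp5
    omega
  have h2 : (2 : ZMod p) ≠ 0 := (two_three_six_ne_zero hp5).1
  have hcx : CentreIn b p x ↔ (x : ZMod p) = c := centreIn_iff_cast b hp5 x
  have hcentre : ∀ (hB : ¬ (p : ℤ) ∣ (b 0 - 2 * x)),
      (1 : ℚ) / ((b 0 : ℚ) / 2 - x) ^ m = (((2 : ℤ) : ℚ)) ^ (m : ℤ) * (((b 0 - 2 * x : ℤ) : ℚ)) ^ (-(m : ℤ)) := by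
    intro hB
    rw [zpow_neg, zpow_natCast, zpow_natCast]
    push_cast
    rw [show (b 0 : ℚ) / 2 - x = ((b 0 : ℚ) - 2 * x) / 2 by ring, div_pow, one_div, inv_div, div_eq_mul_inv]
  have hBden : ¬ p ∣ (if ¬ (2 : ℤ) ∣ b 0 ∧ ¬ CentreIn b p x then 1 / ((b 0 : ℚ) / 2 - x) ^ m else 0 : ℚ).den := by
    split_ifs with h
    · have hB : ¬ (p : ℤ) ∣ (b 0 - 2 * x) := by
        intro hd
        refine h.2 ?_
        unfold CentreIn
        have h' := dvd_neg.2 hd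
        rwa [neg_sub] at h'
      rw [hcentre hB]
      exact PInt.mul (PInt.zpow_int h2Z _) (PInt.zpow_int hB _)
    · exact PInt.zero
  have hBcast : ((if ¬ (2 : ℤ) ∣ b 0 ∧ ¬ CentreIn b p x then 1 / ((b 0 : ℚ) / 2 - x) ^ m else 0 : ℚ) : ZMod p)
      = ∑ w ∈ univ.erase (x : ZMod p),
          ((if ¬ (2 : ℤ) ∣ b 0 ∧ CentreIn b p w.val then (1 : ℤ) else 0 : ℤ) : ZMod p) * ((w - x)⁻¹) ^ m := by
    have hcorr : ∀ w : ZMod p, (¬ (2 : ℤ) ∣ b 0 ∧ CentreIn b p w.val) ↔ (¬ (2 : ℤ) ∣ b 0 ∧ w = c) := by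
      intro w
      rw [centreIn_iff_cast b hp5, ZMod.natCast_zmod_val]
    by_cases hodd : ¬ (2 : ℤ) ∣ b 0
    · have hterm' : ∀ w ∈ univ.erase (x : ZMod p),
          ((if ¬ (2 : ℤ) ∣ b 0 ∧ CentreIn b p w.val then (1 : ℤ) else 0 : ℤ) : ZMod p) * ((w - x)⁻¹) ^ m
            = if w = c then ((w - x)⁻¹) ^ m else 0 := by
        intro w _
        by_cases hw : w = c
        · rw [if_pos ((hcorr w).2 ⟨hodd, hw⟩), if_pos hw, Int.cast_one, one_mul]
        · rw [if_neg (fun h => hw ((hcorr w).1 h).2), if_neg hw, Int.cast_zero, zero_mul]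
      rw [sum_congr rfl hterm', Finset.sum_ite_eq' (univ.erase (x : ZMod p)) c (fun w => ((w - (x : ZMod p))⁻¹) ^ m)]
      by_cases hcen : CentreIn b p x
      · rw [if_neg (fun h => h.2 hcen), if_neg (by rw [mem_erase]; exact fun h => h.1 (hcx.1 hcen).symm),
          Rat.cast_zero]
      · have hne : c ≠ (x : ZMod p) := fun h => hcen (hcx.2 h.symm)
        rw [if_pos ⟨hodd, hcen⟩, if_pos (mem_erase.2 ⟨hne, mem_univ _⟩)]
        have hB : ¬ (p : ℤ) ∣ (b 0 - 2 * x) := by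
          intro hd
          refine hcen ?_
          unfold CentreIn
          have h' := dvd_neg.2 hd
          rwa [neg_sub] at h'
        have hBz : (((b 0 - 2 * x : ℤ)) : ZMod p) ≠ 0 := by
          rwa [Ne, ZMod.intCast_zmod_eq_zero_iff_dvd]
        rw [hcentre hB, PInt.cast_mul (PInt.zpow_int h2Z _) (PInt.zpow_int hB _), PInt.cast_zpow_int h2Z,
          PInt.cast_zpow_int hB, zpow_neg, zpow_natCast, zpow_natCast]
        have hcx2 : c - (x : ZMod p) = ((((b 0 - 2 * x : ℤ)) : ZMod p)) / 2 := by
          rw [eq_div_iff h2, hc, sub_mul, div_mul_cancel₀ _ h2]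
          push_cast
          ring
        rw [hcx2, inv_div, div_pow, div_eq_mul_inv, Int.cast_ofNat]
    · rw [if_neg (fun h => hodd h.1), Rat.cast_zero]
      refine (Finset.sum_eq_zero fun w _ => ?_).symm
      rw [if_neg (fun h => hodd h.1), Int.cast_zero, zero_mul]
  -- assemble
  refine ⟨PInt.add hdenS hBden, ?_⟩
  rw [PInt.cast_add hdenS hBden, hcastS, hfib, hBcast, ← sum_add_distrib]
  refine sum_congr rfl fun w _ => ?_
  unfold classExp
  push_cast
  ring

/-- Reindexing `φ̄_{m,x}(E)` over `ZMod p`. -/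
theorem phiBarPow_eq_sum_univ (E : ℕ → ℤ) {x : ℕ} (hx : x < p) (m : ℕ) :
    phiBarPow p E x m = ∑ w ∈ univ.erase (x : ZMod p), ((E w.val : ℤ) : ZMod p) * ((w - x)⁻¹) ^ m := by
  classical
  unfold phiBarPow
  have hcong : ∀ y ∈ (range p).erase x, ((E y : ℤ) : ZMod p) * (((y : ZMod p) - (x : ZMod p))⁻¹) ^ m
      = (fun w : ZMod p => ((E w.val : ℤ) : ZMod p) * ((w - (x : ZMod p))⁻¹) ^ m) ((y : ℕ) : ZMod p) := by
    intro y hy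
    simp only [ZMod.val_cast_of_lt (mem_range.1 (mem_of_mem_erase hy))]
  rw [Finset.sum_congr rfl hcong]
  exact sum_range_erase_eq_sum_univ_erase
    (fun w : ZMod p => ((E w.val : ℤ) : ZMod p) * ((w - (x : ZMod p))⁻¹) ^ m) hx

/-- `φ̂_x`, `φ̂_{2,x}`, `φ̂_{3,x}` are `p`-integral with images `φ̄₁, φ̄₂, φ̄₃` of the class exponent vector. -/
theorem cast_phiHat_eq (b : ℕ → ℤ) (hp5 : 5 ≤ p) {x : ℕ} (hx : x < p) :
    ¬ p ∣ (phiHat b p x).den ∧ ((phiHat b p x : ℚ) : ZMod p) = phiBarPow p (classExp b p) x 1 := by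
  refine ⟨(cast_phiHat b hp5 x).1, ?_⟩
  rw [(cast_phiHat b hp5 x).2, phiBarPow_eq_sum_univ _ hx]
  simp only [pow_one]

/-- `cast_phi2Hat_eq` (auxiliary lemma). -/
theorem cast_phi2Hat_eq (b : ℕ → ℤ) (hp5 : 5 ≤ p) {x : ℕ} (hx : x < p) :
    ¬ p ∣ (phi2Hat b p x).den ∧ ((phi2Hat b p x : ℚ) : ZMod p) = phiBarPow p (classExp b p) x 2 := by
  rw [phiBarPow_eq_sum_univ _ hx]
  exact cast_phiPow b hp5 x 2

/-- `cast_phi3Hat_eq` (auxiliary lemma). -/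
theorem cast_phi3Hat_eq (b : ℕ → ℤ) (hp5 : 5 ≤ p) {x : ℕ} (hx : x < p) :
    ¬ p ∣ (phi3Hat b p x).den ∧ ((phi3Hat b p x : ℚ) : ZMod p) = phiBarPow p (classExp b p) x 3 := by
  rw [phiBarPow_eq_sum_univ _ hx]
  exact cast_phiPow b hp5 x 3

/-- Division by an integer prime to `p` preserves `p`-integrality and commutes with the cast. -/
theorem cast_div_intCast {q : ℚ} (hq : ¬ p ∣ q.den) {n : ℤ} (hn : ¬ (p : ℤ) ∣ n) :
    ¬ p ∣ (q / n).den ∧ ((q / n : ℚ) : ZMod p) = (q : ZMod p) / (n : ZMod p) := by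
  have h : (q / n : ℚ) = q * ((n : ℚ) ^ (-1 : ℤ)) := by rw [zpow_neg_one, div_eq_mul_inv]
  rw [h]
  exact ⟨PInt.mul hq (PInt.zpow_int hn _),
    by rw [PInt.cast_mul hq (PInt.zpow_int hn _), PInt.cast_zpow_int hn, zpow_neg_one, div_eq_mul_inv]⟩

/-- The LIVE WEIGHT `κ̂_x ∈ {cubicHat, curvHat, phiHat, 1}` is `p`-integral with image the layer weight `κ̄_x`. -/
theorem cast_kappaHat_eq (b : ℕ → ℤ) (hp5 : 5 ≤ p) (M : ℕ) {x : ℕ} (hx : x < p) :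
    ¬ p ∣ ((if classExp b p x + M = 0 then cubicHat b p x else if classExp b p x + M = 1 then curvHat b p x
        else if classExp b p x + M = 2 then phiHat b p x else 1 : ℚ)).den ∧
    (((if classExp b p x + M = 0 then cubicHat b p x else if classExp b p x + M = 1 then curvHat b p x
        else if classExp b p x + M = 2 then phiHat b p x else 1 : ℚ)) : ZMod p) = kapBar p (classExp b p) M x := by
  have hp5' : (5 : ℤ) ≤ p := by exact_mod_cast hp5
  have h2Z : ¬ (p : ℤ) ∣ 2 := fun h => by have := Int.le_of_dvd two_pos h; omega
  have h3Z : ¬ (p : ℤ) ∣ 3 := fun h => by have := Int.le_of_dvd (by norm_num) h; omega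
  have h6Z : ¬ (p : ℤ) ∣ 6 := fun h => by
    rcases (Nat.prime_iff_prime_int.1 hp.out).dvd_or_dvd (show (p : ℤ) ∣ 2 * 3 by norm_num; exact h) with h | h
    · exact h2Z h
    · exact h3Z h
  obtain ⟨hd1, hc1⟩ := cast_phiHat_eq b hp5 hx
  obtain ⟨hd2, hc2⟩ := cast_phi2Hat_eq b hp5 hx
  obtain ⟨hd3, hc3⟩ := cast_phi3Hat_eq b hp5 hx
  unfold kapBar
  by_cases h0 : classExp b p x + M = 0
  · rw [if_pos h0, if_pos h0]
    unfold cubicHat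
    have hA := cast_div_intCast (PInt.pow hd1 3) h6Z
    have hB := cast_div_intCast (PInt.mul hd1 hd2) h2Z
    have hC := cast_div_intCast hd3 h3Z
    rw [show (6 : ℚ) = ((6 : ℤ) : ℚ) by norm_num, show (2 : ℚ) = ((2 : ℤ) : ℚ) by norm_num,
      show (3 : ℚ) = ((3 : ℤ) : ℚ) by norm_num]
    refine ⟨PInt.add (PInt.sub hA.1 hB.1) hC.1, ?_⟩
    rw [PInt.cast_add (PInt.sub hA.1 hB.1) hC.1, PInt.cast_sub hA.1 hB.1, hA.2, hB.2, hC.2,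
      show ((phiHat b p x ^ 3 : ℚ) : ZMod p) = ((phiHat b p x : ℚ) : ZMod p) ^ 3 by
        rw [pow_succ, pow_two, PInt.cast_mul (PInt.mul hd1 hd1) hd1, PInt.cast_mul hd1 hd1]; ring,
      PInt.cast_mul hd1 hd2, hc1, hc2, hc3]
    push_cast
    ring
  · rw [if_neg h0, if_neg h0]
    by_cases h1 : classExp b p x + M = 1
    · rw [if_pos h1, if_pos h1]
      unfold curvHat
      have hA := cast_div_intCast (PInt.sub (PInt.pow hd1 2) hd2) h2Z
      rw [show (2 : ℚ) = ((2 : ℤ) : ℚ) by norm_num]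
      refine ⟨hA.1, ?_⟩
      rw [hA.2, PInt.cast_sub (PInt.pow hd1 2) hd2,
        show ((phiHat b p x ^ 2 : ℚ) : ZMod p) = ((phiHat b p x : ℚ) : ZMod p) ^ 2 by
          rw [pow_two, pow_two, PInt.cast_mul hd1 hd1],
        hc1, hc2]
      push_cast
      ring
    · rw [if_neg h1, if_neg h1]
      by_cases h2 : classExp b p x + M = 2
      · rw [if_pos h2, if_pos h2]; exact ⟨hd1, hc1⟩
      · rw [if_neg h2, if_neg h2]; exact ⟨PInt.one, Rat.cast_one⟩

end Summit.KontsevichZagierPeriods.Zeta5Search.ResidueFour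

/-! ## The residue side of L5 -/

namespace Summit.KontsevichZagierPeriods.Zeta5Search.SecondOrder

open Summit.KontsevichZagierPeriods.Zeta5Search.ClusterValuation
open Summit.KontsevichZagierPeriods.Zeta5Search.ResidueLaw
open Summit.KontsevichZagierPeriods.Zeta5Search.ResidueFour
open Summit.KontsevichZagierPeriods.Zeta5Search.SecondResidueLaw (phi3Hat cubicHat)
open Summit.KontsevichZagierPeriods.Zeta5Search.CasoratianValuation (InPolytope)
open Summit.KontsevichZagierPeriods.Zeta5Search.WedgeDictionary (dOf)

/-- **The residue side of the second residue law L5** (poles of order ≤ 4).  For `b` in the polytope, a prime `p ≥ 5`, an even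
level `M ≥ 10` below every multipole class exponent and `p(M − 4) ≤ 2d + 3`, the live class sum
`Σ_{multipole, E_x ≤ −M+3} ĝ_x κ̂_x` (`κ̂ = cubicHat, curvHat, phiHat, 1` on the layers `E_x + M = 0, 1, 2, 3`) has `p`-adic norm `≤ p⁻¹`. -/
theorem liveKappaSum_small (b : ℕ → ℤ) {p : ℕ} [Fact p.Prime] (hb : InPolytope b) (hp5 : 5 ≤ p) (hpn : (p : ℤ) ≤ b 0)
    (hwin : (b 0 + 2 : ℤ) < (p : ℤ) ^ 2) {M : ℕ} (hM : 10 ≤ M) (hMe : Even M)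
    (H1 : ∀ x ∈ multipoleClasses b p, -(M : ℤ) ≤ classExp b p x) (hdeg : (p : ℤ) * ((M : ℤ) - 4) ≤ 2 * dOf b + 3) :
    padicNorm p (∑ x ∈ (Finset.range p).filter (fun x => 2 ≤ classPoleCount b p x ∧ classExp b p x ≤ -(M : ℤ) + 3),
      gHat b p x * (if classExp b p x + M = 0 then cubicHat b p x else if classExp b p x + M = 1 then curvHat b p x
        else if classExp b p x + M = 2 then phiHat b p x else 1)) ≤ (p : ℚ) ^ (-(1 : ℤ)) := by
  classical
  -- the window hypotheses belong to the interface requested by the `ClassFrame` assembly; the residue argument does not use them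
  have _hwindow : (p : ℤ) ≤ b 0 ∧ (b 0 + 2 : ℤ) < (p : ℤ) ^ 2 := ⟨hpn, hwin⟩
  -- every class exponent is `≥ −M`
  have hE : ∀ y, y < p → -(M : ℤ) ≤ classExp b p y := by
    intro y hy
    by_cases h2 : 2 ≤ classPoleCount b p y
    · exact H1 y (by unfold multipoleClasses; exact mem_filter.2 ⟨mem_range.2 hy, h2⟩)
    · have := neg_six_le_classExp_of_classPoleCount_le_one b p y (by omega)
      omega
  -- the degree condition
  have hdeg' : (p : ℤ) * ((M : ℤ) - 4) + ∑ y ∈ range p, classExp b p y ≤ -2 := by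
    rw [sum_classExp_range b hb hp5]; omega
  -- the live classes are exactly the poles of `∏ (X + w)^{E_w + M − 4}`
  have hfilt : (range p).filter (fun x => 2 ≤ classPoleCount b p x ∧ classExp b p x ≤ -(M : ℤ) + 3)
      = poleSet p (classExp b p) M := by
    ext x
    simp only [mem_filter, mem_range, mem_poleSet]
    constructor
    · rintro ⟨hx, -, hEx⟩; exact ⟨hx, by omega⟩
    · rintro ⟨hx, hEx⟩
      refine ⟨hx, ?_, by omega⟩
      by_contra h2
      have := neg_six_le_classExp_of_classPoleCount_le_one b p x (by omega)
      omega
  -- the abstract identity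
  have hid := sum_gBarE_mul_kapBar_eq_zero (classExp b p) M hp5 (by omega) hMe hE hdeg'
  -- `p`-integrality and the image in `ZMod p`
  have hden : ∀ x ∈ poleSet p (classExp b p) M, ¬ p ∣ (gHat b p x * (if classExp b p x + M = 0 then cubicHat b p x
      else if classExp b p x + M = 1 then curvHat b p x else if classExp b p x + M = 2 then phiHat b p x else 1 : ℚ)).den :=
    fun x hx => PInt.mul (cast_gHat b hp5 x).1 (cast_kappaHat_eq b hp5 M (mem_poleSet.1 hx).1).1
  have hcast : ∀ x ∈ poleSet p (classExp b p) M, ((gHat b p x * (if classExp b p x + M = 0 then cubicHat b p x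
      else if classExp b p x + M = 1 then curvHat b p x else if classExp b p x + M = 2 then phiHat b p x else 1) : ℚ) :
        ZMod p) = 2 * (gBarE p (classExp b p) x * kapBar p (classExp b p) M x) := by
    intro x hx
    have hxp := (mem_poleSet.1 hx).1
    rw [PInt.cast_mul (cast_gHat b hp5 x).1 (cast_kappaHat_eq b hp5 M hxp).1, (cast_kappaHat_eq b hp5 M hxp).2,
      ← gBar_eq_cast_gHat b hp5 hxp, gBar_eq b hxp, mul_assoc]
  rw [hfilt, ← PInt.cast_eq_zero_iff_norm (PInt.sum hden), PInt.cast_sum hden, sum_congr rfl hcast, ← mul_sum, hid, mul_zero]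

end Summit.KontsevichZagierPeriods.Zeta5Search.SecondOrder
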